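import Summits.QuantumFields.YangMills.Theorems.DiagonalMirrorRPRWilsonDiagonalModelSpectralPairing
import Summits.QuantumFields.YangMills.Theorems.DiagonalMirrorRPRWilsonDiagonalModelSlabSupport
import Summits.QuantumFields.YangMills.Theorems.DiagonalMirrorRPRWilsonDiagonalModelMirrorFamily
import Summits.QuantumFields.YangMills.Theorems.DiagonalMirrorRPRWilsonDiagonalModelChainSplit

/-!
# Crux `WeakCouplingHypercubicLimitRP` (stmt-QuantumFields-27398) / aside `DiagonalMirrorRPR` (stmt-QuantumFields-10604), door B,
# construction F1_diag — PAIRING LAYER, step P4/A0: DEFINITIONS for the assembly (slice eigen-package, Gram weights, family readings, slice fields)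

Helper file (`--supports stmt-QuantumFields-27398 --as helper`) of the hand `hand-10604-wilsonDiagModel-2` (docket director-ym O4 WORD 16 (1) /
28, step A of hand-1's ROADMAP-F1diag v4 §1⅞); it closes nothing by itself.  Definitions (reviewed) that the per-slice theorem
(`…SliceFields`) and the assembly `def wilsonDiagonalModel` (`…Model`) consume:

* §1 (second countability of `G` comes from the faithful representation — tree `LatticeRep.secondCountableTopology`; hand-1's operator files
  then apply in the interface's context, which has no `SecondCountableTopology G`);
* §2 `SlicePkg` — the EIGEN-PACKAGE of one slice as DATA (bond bound `M`, operator `A` of `𝔟` on `L²(μ̃)`, Hilbert basis `b` of eigenvectors on a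
  countable set `s`, eigenvalues `κ`, an injection `emb : s → ℕ`, the trace formula) — `nonempty_slicePkg` is hand-1's `exists_eigenPackage`;
  `SlicePkg.gram f i = ∫ bᵢ(x) ∫ blockKernel f (x,y) bᵢ(y)` and the **Gram weights** `SlicePkg.weight f i = κᵢ² · gram f i`, padded along `emb` and
  split by the sign of `κᵢ` into `SlicePkg.wp f`, `SlicePkg.wm f : ℕ → ℝ`;
* §3 `padLayers`, `famRead r sch F k e` — the family observable `Y_k(F)` as a function of the `e + 1` half-layer pairs `1, …, e+1` of the scheme's
  own odd torus (the other layers padded by the identity); `obsR_famRead` (it IS the observable once `Y_k(F)` depends only on layers `1 … d ≤ e+1`),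
  measurability, bound;
* §4 `famDepthSeq r sch F` — a depth sequence of hand-2's `exists_famDepth_layerAssembleU` (chosen); `eventually_goodStep` (the eventual regime
  `2 d_k + 6 ≤ side_k` ∧ slab support);
* §5 `SliceFields r sch k` — ALL fields of `DiagonalSliceModel` at one scheme index `k`, the `F`-dependent identities CONDITIONAL on the regime
  (depth `famDepthSeq F k + 2`); `dummySliceFields` for the finitely many indices with `side_k < 3` (where the regime is void).

HONEST FRAMING: definitions and bookkeeping; `wilsonDiagonalModel` is NOT landed here; no letter is proved; D1, ⟨27398⟩, S6i and the aside ⟨10604⟩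
are OPEN; nothing here bears on the summit; the Yang–Mills mass gap is NOT proved here or anywhere in the tree.  No instance, no notation,
`autoImplicit false`.

References: K. Osterwalder, E. Seiler, Ann. Phys. 110 (1978) §2–3; E. Seiler, LNP 159 (1982) Ch. 2.
-/

set_option autoImplicit false

noncomputable section

open scoped BigOperators ENNReal RealInnerProductSpace
open MeasureTheory Function Filter Topology
open Literature.MathematicalPhysics.QuantumLattice Literature.MathematicalPhysics.QuantumFieldTheory
open Summit.QuantumFields.YangMills.Cruxes.DiagonalMirrorRPR.ParityBridgeColdTraces

namespace Summit.QuantumFields.YangMills.Cruxes.DiagonalMirrorRPR.SignTwistedDiagonalTrace.WilsonDiagonal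

/-! ## §1 (Second countability of `G` from the faithful representation `r` is the tree's
`Literature.MathematicalPhysics.QuantumFieldTheory.LatticeRep.secondCountableTopology`; the slice theorem inlines its one-line proof.) -/

/-! ## §2 The eigen-package of one slice as data; Gram weights -/

section Pkg

variable (S : ℕ) [NeZero S] (G : Type) [Group G] (Nc : ℕ) (ρ : G →* Matrix (Fin Nc) (Fin Nc) ℂ)
variable [TopologicalSpace G] [IsTopologicalGroup G] [CompactSpace G] [MeasurableSpace G] [BorelSpace G]

/-- **The eigen-package of one diagonal slice** (data form of hand-1's `exists_eigenPackage`): bond bound, the `L²(μ̃)` operator of the reweighted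
lifted kernel `𝔟`, a Hilbert basis of eigenvectors on a countable index set with an injection into `ℕ`, the eigenvalues, `Σκ² < ∞` and the trace
formula `Σᵢ κᵢ^{M+2} = diagCyclicTraceU ρ β (M+2) = Tr K_u^{M+2}`. -/
structure SlicePkg (β : ℝ) where
  /-- bound on the bond feature vectors -/
  M : ℝ
  hM : ∀ (Y : HalfCfg S S G) (j : Fin (featDim S Nc)), |bondVec ρ Y j| ≤ M
  /-- the transfer operator of the reweighted lifted kernel -/
  A : Lp ℝ 2 (tMeasure S G Nc β M) →L[ℝ] Lp ℝ 2 (tMeasure S G Nc β M)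
  hA : ∀ φ : Lp ℝ 2 (tMeasure S G Nc β M), (A φ : ℕ × HalfCfg S S G → ℝ) =ᵐ[tMeasure S G Nc β M]
    fun x => ∫ y, bKernel ρ β M x y * φ y ∂(tMeasure S G Nc β M)
  /-- the index set of the eigenbasis -/
  s : Set (Lp ℝ 2 (tMeasure S G Nc β M))
  /-- the eigenbasis -/
  b : HilbertBasis s ℝ (Lp ℝ 2 (tMeasure S G Nc β M))
  /-- the eigenvalues -/
  κ : s → ℝ
  hb : ∀ i, A (b i) = κ i • b i
  countable : Countable s
  summable_sq : Summable fun i => κ i ^ 2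
  trace : ∀ M' : ℕ, HasSum (fun i => κ i ^ (M' + 2)) (diagCyclicTraceU ρ β (M' + 2) (S := S) (G := G))
  /-- an injection of the index set into `ℕ` (the padding of the interface's `ℕ`-indexed data) -/
  emb : s → ℕ
  emb_injective : Function.Injective emb

variable {S G Nc ρ}

/-- The eigen-package exists (`β ≥ 0`, `ρ` continuous unitary). -/
theorem nonempty_slicePkg [SecondCountableTopology G] (hρ : Continuous ρ) {β : ℝ} (hβ : 0 ≤ β)
    (hρu : ∀ g, ρ g ∈ Matrix.unitaryGroup (Fin Nc) ℂ) : Nonempty (SlicePkg S G Nc ρ β) := by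
  obtain ⟨M, A, s, b, κ, hM, hA, -, -, -, hκ, hcount, hsum2, htr⟩ := exists_eigenPackage (S := S) ρ hρ hβ hρu
  haveI := hcount
  obtain ⟨e, he⟩ := Countable.exists_injective_nat s
  exact ⟨⟨M, hM, A, hA, s, b, κ, hκ, hcount, hsum2, htr, e, he⟩⟩

variable {β : ℝ}

/-- The Gram element `⟪bᵢ, 𝒲_f bᵢ⟫` written out: `∫ bᵢ(x) ∫ blockKernel f (x, y) bᵢ(y) dμ̃ dμ̃`. -/
def SlicePkg.gram (P : SlicePkg S G Nc ρ β) {e : ℕ} (f : (Fin (e + 1) → HalfCfg S S G) → (Fin (e + 1) → HalfCfg S S G) → ℝ)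
    (i : P.s) : ℝ :=
  ∫ x, P.b i x * ∫ y, blockKernel S G Nc ρ β P.M f x y * P.b i y ∂(tMeasure S G Nc β P.M) ∂(tMeasure S G Nc β P.M)

/-- **The Gram weight** of the eigenvector `bᵢ` for the observable `f`: `κᵢ² · ⟪bᵢ, 𝒲_f bᵢ⟫` (the two extra powers make the `t = 0` domination
uniform with `t ≥ 1`; the interface depth is the block half-width plus one). -/
def SlicePkg.weight (P : SlicePkg S G Nc ρ β) {e : ℕ} (f : (Fin (e + 1) → HalfCfg S S G) → (Fin (e + 1) → HalfCfg S S G) → ℝ)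
    (i : P.s) : ℝ :=
  P.κ i ^ 2 * P.gram f i

/-- The Gram weights on the positive sector, padded along `emb`. -/
def SlicePkg.wp (P : SlicePkg S G Nc ρ β) {e : ℕ} (f : (Fin (e + 1) → HalfCfg S S G) → (Fin (e + 1) → HalfCfg S S G) → ℝ) :
    ℕ → ℝ :=
  Function.extend P.emb (fun i => if 0 < P.κ i then P.weight f i else 0) 0

/-- The Gram weights on the negative (wrong-sign) sector, padded along `emb`. -/
def SlicePkg.wm (P : SlicePkg S G Nc ρ β) {e : ℕ} (f : (Fin (e + 1) → HalfCfg S S G) → (Fin (e + 1) → HalfCfg S S G) → ℝ) :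
    ℕ → ℝ :=
  Function.extend P.emb (fun i => if P.κ i < 0 then P.weight f i else 0) 0

end Pkg

/-! ## §3 The family observable as a function of `e + 1` half-layer pairs -/

section Read

variable {S : ℕ} [NeZero S] {G : Type}

/-- Padding `e + 1` half-layer pairs into a full layer string of the torus `ℤ/Sℤ`: layers `1, …, e+1` carry the given pairs, every other layer is the
identity configuration. -/
def padLayers [One G] (e : ℕ) (Y X : Fin (e + 1) → HalfCfg S S G) : ZMod S → LayerCfg S S G :=
  fun t => if h : 1 ≤ t.val ∧ t.val ≤ e + 1 then glue (Y ⟨t.val - 1, by omega⟩) (X ⟨t.val - 1, by omega⟩) else fun _ => 1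

variable [Group G] [TopologicalSpace G] [IsTopologicalGroup G] [CompactSpace G] [MeasurableSpace G] [BorelSpace G]
  (r : LatticeRep G) (sch : SpeciesScheme (YMSpecies G))

/-- **The family observable read on `e + 1` half-layer pairs**: `famRead r sch F k e (Y, X) = Y_k(F)` at the periodic lift of the own-torus
configuration assembled from the layer string `padLayers e Y X`. -/
def famRead (F : ReflectedFamily) (k : ℕ) (e : ℕ)
    (Y X : Fin (e + 1) → HalfCfg (sch.side k) (sch.side k) G) : ℝ :=
  famObs r sch F k (torusLift (sch.side k) (layerAssembleU (padLayers e Y X)))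

/-- `famRead` is bounded (by the bound of the family observable). -/
theorem abs_famRead_le (F : ReflectedFamily) (k e : ℕ) {B : ℝ} (hB : ∀ V : LGConfig 4 G, |famObs r sch F k V| ≤ B)
    (Y X : Fin (e + 1) → HalfCfg (sch.side k) (sch.side k) G) : |famRead r sch F k e Y X| ≤ B :=
  hB _

omit [Group G] [TopologicalSpace G] [IsTopologicalGroup G] [CompactSpace G] [BorelSpace G] in
/-- Assembling a torus configuration from a layer string is measurable. -/
theorem measurable_layerAssembleU' {S' : ℕ} : Measurable (layerAssembleU : (ZMod S' → LayerCfg S' S' G) → GaugeConfig 4 S' G) :=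
  measurable_pi_lambda _ fun _ => (measurable_pi_apply _).comp (measurable_pi_apply _)

omit [TopologicalSpace G] [IsTopologicalGroup G] [CompactSpace G] [BorelSpace G] in
/-- Padding is measurable in the pairs. -/
theorem measurable_padLayers {S' : ℕ} [NeZero S'] (e : ℕ) :
    Measurable fun p : (Fin (e + 1) → HalfCfg S' S' G) × (Fin (e + 1) → HalfCfg S' S' G) => padLayers e p.1 p.2 := by
  refine measurable_pi_lambda _ fun t => ?_
  by_cases h : 1 ≤ t.val ∧ t.val ≤ e + 1
  · simp only [padLayers, h, and_self, dif_pos]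
    refine measurable_pi_lambda _ fun q => ?_
    unfold glue
    split_ifs
    · exact (measurable_pi_apply _).comp ((measurable_pi_apply _).comp measurable_fst)
    · exact (measurable_pi_apply _).comp ((measurable_pi_apply _).comp measurable_snd)
  · simp only [padLayers, h, dif_neg, not_false_eq_true]
    exact measurable_const

/-- `famRead` is jointly measurable in the pairs. -/
theorem measurable_famRead (F : ReflectedFamily) (k e : ℕ) : Measurable (uncurry (famRead r sch F k e)) := by
  have h := (measurable_famObs_torusLift r sch F k).comp
    ((measurable_layerAssembleU' (G := G)).comp (measurable_padLayers (G := G) (S' := sch.side k) e))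
  exact h

/-- **`famRead` IS the observable** once `Y_k(F)` depends only on the layers `1, …, d` with `d ≤ e + 1 < side_k`:
`obsR (famRead F k e) P = Y_k(F)(assembled P)` for every pair string `P` of the own torus. -/
theorem obsR_famRead (F : ReflectedFamily) (k e d : ℕ) (hde : d ≤ e + 1) (he : e + 1 < sch.side k)
    (hdep : ∀ Z Z' : ZMod (sch.side k) → LayerCfg (sch.side k) (sch.side k) G,
      (∀ t : ℤ, 1 ≤ t → t ≤ d → Z (t : ZMod (sch.side k)) = Z' (t : ZMod (sch.side k))) →
      famObs r sch F k (torusLift (sch.side k) (layerAssembleU Z)) = famObs r sch F k (torusLift (sch.side k) (layerAssembleU Z')))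
    (P : ZMod (sch.side k) → HalfCfg (sch.side k) (sch.side k) G × HalfCfg (sch.side k) (sch.side k) G) :
    obsR (famRead r sch F k e) P = famObs r sch F k (torusLift (sch.side k) (layerAssembleU fun t => glue (P t).1 (P t).2)) := by
  unfold obsR famRead
  refine hdep _ _ fun t ht1 htd => ?_
  obtain ⟨tn, rfl⟩ := Int.eq_ofNat_of_zero_le (by omega : (0 : ℤ) ≤ t)
  have htn1 : 1 ≤ tn := by exact_mod_cast ht1
  have htnd : tn ≤ d := by exact_mod_cast htd
  have hcast : ((tn : ℤ) : ZMod (sch.side k)) = ((tn : ℕ) : ZMod (sch.side k)) := by push_cast; rfl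
  rw [hcast]
  have hval : ((tn : ℕ) : ZMod (sch.side k)).val = tn := by
    rw [ZMod.val_natCast, Nat.mod_eq_of_lt (by omega)]
  have hcond : 1 ≤ ((tn : ℕ) : ZMod (sch.side k)).val ∧ ((tn : ℕ) : ZMod (sch.side k)).val ≤ e + 1 := by
    rw [hval]; exact ⟨htn1, by omega⟩
  simp only [padLayers, hcond, and_self, dif_pos]
  have hidx : (((((tn : ℕ) : ZMod (sch.side k)).val - 1 + 1 : ℕ)) : ZMod (sch.side k)) = ((tn : ℕ) : ZMod (sch.side k)) := by
    rw [hval, Nat.sub_add_cancel htn1]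
  simp only [hidx]

end Read

/-! ## §4 The depth sequence of a reflected family and the eventual regime -/

section DepthSeq

variable {G : Type} [Group G] [TopologicalSpace G] [IsTopologicalGroup G] [CompactSpace G] [MeasurableSpace G] [BorelSpace G]
  (r : LatticeRep G) (sch : SpeciesScheme (YMSpecies G))

/-- **A depth sequence of the reflected family** (chosen from hand-2's `exists_famDepth_layerAssembleU`): `a_k d_k` bounded, `2 d_k < side_k`
eventually, and eventually `Y_k(F)` depends only on the layers `1, …, d_k` of the own torus. -/
def famDepthSeq (F : ReflectedFamily) : ℕ → ℕ := Classical.choose (exists_famDepth_layerAssembleU r sch F)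

/-- The defining properties of `famDepthSeq`. -/
theorem famDepthSeq_spec (F : ReflectedFamily) :
    (∃ R' : ℝ, ∀ᶠ k in atTop, sch.a k * famDepthSeq r sch F k ≤ R') ∧ (∀ᶠ k in atTop, 2 * famDepthSeq r sch F k < sch.side k) ∧
      ∀ᶠ k in atTop, ∀ Z Z' : ZMod (sch.side k) → LayerCfg (sch.side k) (sch.side k) G,
        (∀ t : ℤ, 1 ≤ t → t ≤ famDepthSeq r sch F k → Z (t : ZMod (sch.side k)) = Z' (t : ZMod (sch.side k))) →
        famObs r sch F k (torusLift (sch.side k) (layerAssembleU Z)) = famObs r sch F k (torusLift (sch.side k) (layerAssembleU Z')) :=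
  Classical.choose_spec (exists_famDepth_layerAssembleU r sch F)

/-- **The eventual regime** of a reflected family: eventually in `k`, the block of half-width `d_k + 1` and its two boundary layers fit twice
into the own torus (`2 d_k + 6 ≤ side_k`) and `Y_k(F)` depends only on the layers `1, …, d_k`. -/
theorem eventually_goodStep (F : ReflectedFamily) : ∀ᶠ k in atTop, 2 * famDepthSeq r sch F k + 6 ≤ sch.side k ∧
    ∀ Z Z' : ZMod (sch.side k) → LayerCfg (sch.side k) (sch.side k) G,
      (∀ t : ℤ, 1 ≤ t → t ≤ famDepthSeq r sch F k → Z (t : ZMod (sch.side k)) = Z' (t : ZMod (sch.side k))) →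
      famObs r sch F k (torusLift (sch.side k) (layerAssembleU Z)) = famObs r sch F k (torusLift (sch.side k) (layerAssembleU Z')) := by
  obtain ⟨⟨R', hR'⟩, -, hdep⟩ := famDepthSeq_spec r sch F
  have ha1 : ∀ᶠ k in atTop, sch.a k ≤ 1 := ((tendsto_order.1 sch.tendsto_a).2 1 one_pos).mono fun k hk => hk.le
  have hbd : ∃ R'' : ℝ, ∀ᶠ k in atTop, sch.a k * ((famDepthSeq r sch F k + 2 : ℕ) : ℝ) ≤ R'' := by
    refine ⟨R' + 2, ?_⟩
    filter_upwards [hR', ha1] with k hk hk1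
    have ha := (sch.a_pos k).le
    push_cast
    nlinarith
  have h2 := eventually_two_mul_add_two_le_side sch (d := fun k => famDepthSeq r sch F k + 2) hbd
  filter_upwards [h2, hdep] with k hk hk'
  exact ⟨by omega, hk'⟩

/-- The depth plus two is still of bounded physical size (the interface field `depth_le`). -/
theorem exists_a_mul_famDepthSeq_add_two_le (F : ReflectedFamily) :
    ∃ R : ℝ, ∀ᶠ k in atTop, sch.a k * ((famDepthSeq r sch F k + 2 : ℕ) : ℝ) ≤ R := by
  obtain ⟨⟨R', hR'⟩, -, -⟩ := famDepthSeq_spec r sch F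
  have ha1 : ∀ᶠ k in atTop, sch.a k ≤ 1 := ((tendsto_order.1 sch.tendsto_a).2 1 one_pos).mono fun k hk => hk.le
  refine ⟨R' + 2, ?_⟩
  filter_upwards [hR', ha1] with k hk hk1
  have ha := (sch.a_pos k).le
  push_cast
  nlinarith

end DepthSeq

/-! ## §5 All fields of the interface at one scheme index -/

section Fields

variable {G : Type} [Group G] [TopologicalSpace G] [IsTopologicalGroup G] [CompactSpace G] [MeasurableSpace G] [BorelSpace G]
  (r : LatticeRep G) (sch : SpeciesScheme (YMSpecies G))

/-- **The fields of `DiagonalSliceModel r sch` at ONE scheme index `k`**: the spectral data `sp, sm, top` with the nine spectral fields, and for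
every reflected family `F` the Gram weights `wp F, wm F : ℕ → ℝ` (non-negative, bounded) with the pairing identity and the weight domination at
depth `famDepthSeq F k + 2`, both CONDITIONAL on the eventual regime (`2 d_k + 6 ≤ side_k` and slab support of `Y_k(F)` in the layers `1 … d_k`,
`eventually_goodStep`). -/
structure SliceFields (k : ℕ) where
  /-- moduli on the positive sector -/
  sp : ℕ → ℝ
  /-- moduli on the negative sector -/
  sm : ℕ → ℝ
  /-- top modulus -/
  top : ℝ
  top_pos : 0 < top
  sp_nonneg : ∀ j, 0 ≤ sp j
  sm_nonneg : ∀ j, 0 ≤ sm j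
  sp_le : ∀ j, sp j ≤ top
  sm_le : ∀ j, sm j ≤ top
  top_attained : ∃ j, sp j = top ∨ sm j = top
  summable_sp : Summable fun j => sp j ^ 2
  summable_sm : Summable fun j => sm j ^ 2
  trace_nonneg : ∀ m, 3 ≤ m → Odd m → ∑' j, sm j ^ m ≤ ∑' j, sp j ^ m
  trace_side_pos : ∑' j, sm j ^ sch.side k < ∑' j, sp j ^ sch.side k
  /-- Gram weights of reflected families at this index -/
  wp : ReflectedFamily → ℕ → ℝ
  wm : ReflectedFamily → ℕ → ℝ
  wp_nonneg : ∀ F j, 0 ≤ wp F j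
  wm_nonneg : ∀ F j, 0 ≤ wm F j
  w_bdd : ∀ F, ∃ W : ℝ, ∀ j, wp F j ≤ W ∧ wm F j ≤ W
  pairing : ∀ F, 2 * famDepthSeq r sch F k + 6 ≤ sch.side k →
    (∀ Z Z' : ZMod (sch.side k) → LayerCfg (sch.side k) (sch.side k) G,
      (∀ t : ℤ, 1 ≤ t → t ≤ famDepthSeq r sch F k → Z (t : ZMod (sch.side k)) = Z' (t : ZMod (sch.side k))) →
      famObs r sch F k (torusLift (sch.side k) (layerAssembleU Z)) = famObs r sch F k (torusLift (sch.side k) (layerAssembleU Z'))) →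
    gramPairing r sch F k * (∑' j, sp j ^ sch.side k - ∑' j, sm j ^ sch.side k) =
      ∑' j, sp j ^ (sch.side k - 2 * (famDepthSeq r sch F k + 2)) * wp F j -
        ∑' j, sm j ^ (sch.side k - 2 * (famDepthSeq r sch F k + 2)) * wm F j
  dom : ∀ F, 2 * famDepthSeq r sch F k + 6 ≤ sch.side k →
    (∀ Z Z' : ZMod (sch.side k) → LayerCfg (sch.side k) (sch.side k) G,
      (∀ t : ℤ, 1 ≤ t → t ≤ famDepthSeq r sch F k → Z (t : ZMod (sch.side k)) = Z' (t : ZMod (sch.side k))) →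
      famObs r sch F k (torusLift (sch.side k) (layerAssembleU Z)) = famObs r sch F k (torusLift (sch.side k) (layerAssembleU Z'))) →
    ∀ (t : ℕ) (B : ℝ), (∀ V, |famObs r sch F k V| ≤ B) →
    ∑' j, sp j ^ (2 * t) * wp F j + ∑' j, sm j ^ (2 * t) * wm F j ≤
      B ^ 2 * (∑' j, sp j ^ (2 * t + 2 * (famDepthSeq r sch F k + 2)) + ∑' j, sm j ^ (2 * t + 2 * (famDepthSeq r sch F k + 2)))

/-- **Dummy slice fields** for the finitely many indices with `side_k < 3` (there the regime is void, since it requires `side_k ≥ 6`):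
`sp = 𝟙_{j=0}`, `sm = 0`, `top = 1`, all weights `0`. -/
def dummySliceFields (k : ℕ) (hk : sch.side k < 3) : SliceFields r sch k where
  sp := fun j => if j = 0 then 1 else 0
  sm := fun _ => 0
  top := 1
  top_pos := one_pos
  sp_nonneg := fun j => by split_ifs <;> norm_num
  sm_nonneg := fun _ => le_rfl
  sp_le := fun j => by split_ifs <;> norm_num
  sm_le := fun _ => zero_le_one
  top_attained := ⟨0, Or.inl (if_pos rfl)⟩
  summable_sp := by
    have h : (fun j : ℕ => (if j = 0 then (1 : ℝ) else 0) ^ 2) = fun j => if j = 0 then (1 : ℝ) else 0 := by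
      funext j; split_ifs <;> simp
    rw [h]
    exact (hasSum_ite_eq 0 (1 : ℝ)).summable
  summable_sm := by
    simp only [zero_pow two_ne_zero]
    exact summable_zero
  trace_nonneg := fun m hm _ => by
    have hm0 : m ≠ 0 := by omega
    simp only [zero_pow hm0, tsum_zero]
    exact tsum_nonneg fun j => by split_ifs <;> simp
  trace_side_pos := by
    have hS0 : sch.side k ≠ 0 := by simp [SpeciesScheme.side]
    have h1 : (fun j : ℕ => (if j = 0 then (1 : ℝ) else 0) ^ sch.side k) = fun j => if j = 0 then 1 else 0 := by
      funext j; split_ifs <;> simp [zero_pow hS0]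
    rw [h1, tsum_ite_eq]
    simp [zero_pow hS0]
  wp := fun _ _ => 0
  wm := fun _ _ => 0
  wp_nonneg := fun _ _ => le_rfl
  wm_nonneg := fun _ _ => le_rfl
  w_bdd := fun _ => ⟨0, fun _ => ⟨le_rfl, le_rfl⟩⟩
  pairing := fun F hF _ => absurd hF (by omega)
  dom := fun F hF _ => absurd hF (by omega)

end Fields

end Summit.QuantumFields.YangMills.Cruxes.DiagonalMirrorRPR.SignTwistedDiagonalTrace.WilsonDiagonal

end
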